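import Summits.QuantumFields.BalabanUV.Beta.D1BFx.HessKerConjugation

/-!
# `BalabanUV.Beta.D1BFx.ColumnGaugeInvariance` — road «BF-x», row D1, slot (K) ∕ PART 24 (β″): **THE ONE-LOOP FUNCTIONAL IS INVARIANT UNDER A PURE-GAUGE
# CHANGE OF THE PACKING COLUMN — an IDENTITY from the slot Ward letters and cyclicity, generic in the kernel** (OWNER notes F-g23-1 ∕ N-g23-2 ∕ A-1,
# `OWNER-MEMO-g23.md` §1b, `PART24-SPEC-g23.md`).

WHY.  At the road's pin `G₀^{bm}(ctrOff)` the packing column carries PURE-GAUGE FACE SHEETS (Engine C D-g22-1 A-g23-1 (b): the dressed column's sup grows like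
`n⁻⁴` while the straight column's is `n⁻⁵`-flat); per word these sheets cost powers of `n` in the channel the END reads (edge class), while their SUM over the
word family cancels — the infinitesimal background-gauge invariance of `½ log det 𝕄`.  This file proves that cancellation as EXACT ALGEBRA in an5's tame kernel
calculus, for an ABSTRACT resolvent pair `K ∘ M = M ∘ K = 1` (both spread), localised vertex families `V`, `W`, and localised «rotation generators» `Λ μ y`
(one per coarse bond — in the application `Λ_{μ,y} = ad χ_{μ,y}` for the sheet gauge function of the `(μ, y)`-column):
* the PURE-GAUGE FIRST-ORDER VERTICES `G μ y` are tied to the rotation generators by the SANDWICH LETTER `K ∘ G μ y ∘ K = K∘Λ μ y − Λ μ y∘K` (a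
  HYPOTHESIS of §2 — exactly the shape of the road's displayed `hW1`: `Ga∘(divV S u)∘Ga = Ga∘X − X∘Ga`; for a two-sided inverse `K∘M = M∘K = 1` it is a THEOREM
  for the commutator `G := Λ∘M − M∘Λ` — `sandwich_of_inverse`; for the road's RELATIVE inverses it is the instance's letter);
* the SECOND-ORDER letters: mixed `Wmix μ y ν y′ := [Λ ν y′, V μ y] + [Λ μ y, V ν y′]` (covariance of the first-order family), gauge–gauge
  `Wgg μ y ν y′ := [Λ μ y, G ν y′]`;
* §1 the trace identities, each ONE sandwich + cyclicity: `bubble K V G′ = tadpole K [Λ′, V]` (`bubble_gauge_right`), `bubble K G V′ = tadpole K [Λ, V′]`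
  (`bubble_gauge_left`; at `V′ := G′` the gauge–gauge bubble);
* §2 **`hessKer_columnGauge`**: `hessKer K (V + G) (W + ((Wmix + Wgg) + Nr)) μ ν z = hessKer K V W μ ν z` (`Nr` any localised tadpole-null remainder) — every cross term and the gauge–gauge term cancel between
  `½·tadpole` and `½·bubble` (`HessKerConjugation.hessKer_add_add` + §1 + `ring`); `hessKer_columnGauge_of_inverse` = the two-sided-inverse instance.
CONSEQUENCE FOR PART 24 (the INSTANCE is a later file, after an2's chart ruling Q-g23-1): with leaf-01's L-h♭ decomposition `colH(G₀^{bm}) = colH(KInv) − dχ_r` and the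
slot Ward letters of the road's tables (an1 `AveragingWardRootedKernels` ∕ `KernelWardRelative.divV_vertexOfK`, an3's plaquette laws; model side = PART 23-hyb's `hW1`∕`hW2`
sockets), the road's words at the bm pin SUM to the all-smooth-column words EXACTLY, and only those need per-word pricing (PART24-SPEC §1, slope-free).

HONEST DEPENDENCY (cell records, verbatim): «continuum YM on T⁴ ⇐ BetaPertH ∧ nine spine estimates (0/9 proved); BetaPertH ⇐ (D1) ∧ (D4) ∧
CAP+tail; G-an2-4 gates asym, D1 and NE2/3/4.»  HONEST FRAMING (cell contract, verbatim): «discharging `BetaPertH` makes Bałaban's UV stability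
UNCONDITIONAL — a real constructive-QFT result; it is NOT the continuum limit and NOT the Clay problem.»  THIS MODULE DISCHARGES NOTHING of the wall:
[folklore] tame-kernel algebra (associativity `comp_assoc_tame`, cyclicity `tr_comp_comm_loc`, `comp_idK_left∕right`) over ABSTRACT kernels; the Ward letters
are HYPOTHESES ∕ the DEFINITIONS of `Wmix`, `Wgg` here — whether the road's tables produce them is the instance's burden, not claimed.  No definition, no `def … : Prop`,
nothing cited, 0 sorry.  0∕4 row-D1 binders; (K) NOT closed; (J1) ONE OPEN ROW; NOT D1, NEVER «G-an2-4 closed», NOT `BetaPertH`, NOT continuum, NOT Clay.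

ABSOLUTE RULE (cell charter, verbatim): «No internally-minted statement may enter as a cited fact. Every hypothesis is either kernel-proved in this
package or a verbatim quotation of a PUBLISHED theorem with page reference. The manuscript(s) under audit are NOT citable for their own disputed
steps — they are the thing under adjudication; programme-internal (2001/route/tribunal) claims are never citable.»

Unit `b2b-balaban-beta-d1-p2` (road owner, gen 23), 2026-08-23; no existing file touched.
-/

noncomputable section

namespace Summit.QuantumFields.BalabanUV.Beta.D1BFx.ColumnGaugeInvariance

open Literature.MathematicalPhysics.QuantumFieldTheory.Balaban1983to89
open Literature.MathematicalPhysics.QuantumFieldTheory.Balaban1983to89.Beta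
open ExpKernelCalculus (MKer comp tr tadpole bubble hessKer)
open HessKerSchurResolvent (idK comp_idK_left comp_idK_right)
open Summit.QuantumFields.BalabanUV.Beta.TameKernelCalculus
open Summit.QuantumFields.BalabanUV.Beta.ChartConjugationRelative (spr_comp)
open Summit.QuantumFields.BalabanUV.Beta.D1BFx.HessKerConjugation (hessKer_add_add)

variable {D : ℕ} {F : Type*} [Fintype F] [DecidableEq F]

/-! ## §1 The sandwich letter and the three trace identities -/

section Traces

variable {K : MKer D F} (hK : Spr K)
include hK

/-- [folklore] **THE SANDWICH FROM A TWO-SIDED INVERSE**: if `K∘M = M∘K = 1` (both spread) then the commutator vertex `G := Λ∘M − M∘Λ` satisfies the sandwich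
letter `K∘G∘K = K∘Λ − Λ∘K` (the shape of the road's displayed `hW1`).  For a RELATIVE inverse (`RelInv K M E` with `Λ∘E = E∘Λ`) the same letter holds — the
instance's business; below the letter is a HYPOTHESIS, so either source feeds §2. -/
theorem sandwich_of_inverse {M Λ : MKer D F} (hM : Spr M) (hKM : comp K M = idK) (hMK : comp M K = idK) (hΛ : Loc Λ) :
    comp (comp K (comp Λ M - comp M Λ)) K = comp K Λ - comp Λ K := by
  have hΛM : Loc (comp Λ M) := hΛ.comp_spr hM
  have hMΛ : Loc (comp M Λ) := hM.comp_loc hΛ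
  rw [comp_sub_right_tame hK.tame hΛM.tame hMΛ.tame, comp_sub_left_tame (hK.comp_loc hΛM).tame (hK.comp_loc hMΛ).tame hK.tame]
  -- `(K∘(Λ∘M))∘K = K∘(Λ∘(M∘K)) = K∘Λ`
  have e1 : comp (comp K (comp Λ M)) K = comp K Λ := by
    rw [← comp_assoc_tame hK.tame hΛM.tame hK.tame, ← comp_assoc_tame hΛ.tame hM.tame hK.tame, hMK, comp_idK_right]
  -- `(K∘(M∘Λ))∘K = ((K∘M)∘Λ)∘K = Λ∘K`
  have e2 : comp (comp K (comp M Λ)) K = comp Λ K := by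
    rw [comp_assoc_tame hK.tame hM.tame hΛ.tame, hKM, comp_idK_left]
  rw [e1, e2]

omit [DecidableEq F] hK in
/-- [folklore] The commutator vertex `Λ∘M − M∘Λ` of a localised generator with a spread operator is localised. -/
theorem loc_comm_spr {M Λ : MKer D F} (hM : Spr M) (hΛ : Loc Λ) : Loc (comp Λ M - comp M Λ) :=
  (hΛ.comp_spr hM).sub (hM.comp_loc hΛ)

omit [DecidableEq F] in
/-- [folklore] **(X1) THE CROSS BUBBLE WITH THE GAUGE VERTEX ON THE RIGHT IS A ROTATION TADPOLE**: under the sandwich letter `K∘G′∘K = K∘Λ′ − Λ′∘K`,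
`bubble K V G′ = tadpole K (Λ′∘V − V∘Λ′)` (`= tr(KΛ′V) − tr(KVΛ′)`; one sandwich, two cyclic moves). -/
theorem bubble_gauge_right {V G' Λ' : MKer D F} (hV : Loc V) (hG' : Loc G') (hΛ' : Loc Λ')
    (hsand : comp (comp K G') K = comp K Λ' - comp Λ' K) :
    bubble K V G' = tadpole K (comp Λ' V - comp V Λ') := by
  have hKV : Loc (comp K V) := hK.comp_loc hV
  have hKG' : Loc (comp K G') := hK.comp_loc hG'
  unfold ExpKernelCalculus.bubble ExpKernelCalculus.tadpole
  -- cycle `K∘V` to the back, re-associate, apply the sandwich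
  rw [tr_comp_comm_loc hKV hKG'.tame, comp_assoc_tame hKG'.tame hK.tame hV.tame, hsand,
    comp_sub_left_tame (hK.comp_loc hΛ').tame (hΛ'.comp_spr hK).tame hV.tame,
    tr_sub_loc ((hK.comp_loc hΛ').comp hV) ((hΛ'.comp_spr hK).comp hV),
    comp_sub_right_tame hK.tame (hΛ'.comp hV).tame (hV.comp hΛ').tame,
    tr_sub_loc (hK.comp_loc (hΛ'.comp hV)) (hK.comp_loc (hV.comp hΛ'))]
  -- `tr((KΛ′)V) = tr(K(Λ′V))` and `tr((Λ′K)V) = tr(Λ′(KV)) = tr((KV)Λ′) = tr(K(VΛ′))`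
  rw [← comp_assoc_tame hK.tame hΛ'.tame hV.tame, ← comp_assoc_tame hΛ'.tame hK.tame hV.tame, tr_comp_comm_loc hΛ' hKV.tame,
    ← comp_assoc_tame hK.tame hV.tame hΛ'.tame]

omit [DecidableEq F] in
/-- [folklore] **(X2) THE CROSS BUBBLE WITH THE GAUGE VERTEX ON THE LEFT**: under `K∘G∘K = K∘Λ − Λ∘K`, `bubble K G V′ = tadpole K (Λ∘V′ − V′∘Λ)`. -/
theorem bubble_gauge_left {V' G Λ : MKer D F} (hV' : Loc V') (hG : Loc G) (hΛ : Loc Λ)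
    (hsand : comp (comp K G) K = comp K Λ - comp Λ K) :
    bubble K G V' = tadpole K (comp Λ V' - comp V' Λ) := by
  have hKV' : Loc (comp K V') := hK.comp_loc hV'
  have hKG : Loc (comp K G) := hK.comp_loc hG
  unfold ExpKernelCalculus.bubble ExpKernelCalculus.tadpole
  rw [comp_assoc_tame hKG.tame hK.tame hV'.tame, hsand,
    comp_sub_left_tame (hK.comp_loc hΛ).tame (hΛ.comp_spr hK).tame hV'.tame,
    tr_sub_loc ((hK.comp_loc hΛ).comp hV') ((hΛ.comp_spr hK).comp hV'),
    comp_sub_right_tame hK.tame (hΛ.comp hV').tame (hV'.comp hΛ).tame,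
    tr_sub_loc (hK.comp_loc (hΛ.comp hV')) (hK.comp_loc (hV'.comp hΛ))]
  rw [← comp_assoc_tame hK.tame hΛ.tame hV'.tame, ← comp_assoc_tame hΛ.tame hK.tame hV'.tame, tr_comp_comm_loc hΛ hKV'.tame,
    ← comp_assoc_tame hK.tame hV'.tame hΛ.tame]

end Traces

/-! ## §2 The invariance of the one-loop functional under a pure-gauge change of the column -/

section Invariance

variable {K : MKer D F} (hK : Spr K)
  {V G Λ : Fin D → (Fin D → ℤ) → MKer D F} {W Nr : Fin D → (Fin D → ℤ) → Fin D → (Fin D → ℤ) → MKer D F}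
  (hV : ∀ μ y, Loc (V μ y)) (hG : ∀ μ y, Loc (G μ y)) (hΛ : ∀ μ y, Loc (Λ μ y)) (hW : ∀ μ y ν y', Loc (W μ y ν y'))
  (hsand : ∀ μ y, comp (comp K (G μ y)) K = comp K (Λ μ y) - comp (Λ μ y) K)
  (hNr : ∀ μ y ν y', Loc (Nr μ y ν y')) (hN0 : ∀ μ y ν y', tadpole K (Nr μ y ν y') = 0)
include hK hV hG hΛ hW hsand hNr hN0

omit [DecidableEq F] in
/-- [folklore] **COLUMN-GAUGE INVARIANCE OF THE ONE-LOOP FUNCTIONAL.**  Spread `K`; localised vertex families `V`, `W`; localised pure-gauge first-order vertices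
`G μ y` with rotation generators `Λ μ y` tied by the SANDWICH LETTER `K∘G μ y∘K = K∘Λ μ y − Λ μ y∘K` (first slot Ward identity in resolvent form — the road's
`hW1` shape); second-order letters: mixed `Wmix μ y ν y′ := (Λ ν y′ ∘ V μ y − V μ y ∘ Λ ν y′) + (Λ μ y ∘ V ν y′ − V ν y′ ∘ Λ μ y)` (covariance of the first-order
family), gauge–gauge `Wgg μ y ν y′ := Λ μ y ∘ G ν y′ − G ν y′ ∘ Λ μ y`, plus ANY localised TADPOLE-NULL remainder `Nr` (`tadpole K (Nr …) = 0`; the shape of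
the road's coarse Ward letter `hWd … + Nr` in `KernelWardRelative.wardTransversal_flip_hessKer_conj_rel`).  THEN
`hessKer K (V + G) (W + ((Wmix + Wgg) + Nr)) μ ν z = hessKer K V W μ ν z` — every cross term and the gauge–gauge term cancel between `½·tadpole` and `½·bubble`. -/
theorem hessKer_columnGauge (μ ν : Fin D) (z : Fin D → ℤ) :
    hessKer K (fun μ' y => V μ' y + G μ' y)
        (fun μ' y ν' y' => W μ' y ν' y'
          + ((((comp (Λ ν' y') (V μ' y) - comp (V μ' y) (Λ ν' y')) + (comp (Λ μ' y) (V ν' y') - comp (V ν' y') (Λ μ' y)))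
            + (comp (Λ μ' y) (G ν' y') - comp (G ν' y') (Λ μ' y))) + Nr μ' y ν' y')) μ ν z
      = hessKer K V W μ ν z := by
  have hC : ∀ (X Y : MKer D F), Loc X → Loc Y → Loc (comp X Y - comp Y X) := fun X Y hX hY => (hX.comp hY).sub (hY.comp hX)
  have hmix : ∀ μ y ν y', Loc ((comp (Λ ν y') (V μ y) - comp (V μ y) (Λ ν y')) + (comp (Λ μ y) (V ν y') - comp (V ν y') (Λ μ y))) :=
    fun μ y ν y' => (hC _ _ (hΛ ν y') (hV μ y)).add (hC _ _ (hΛ μ y) (hV ν y'))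
  have hgg : ∀ μ y ν y', Loc (comp (Λ μ y) (G ν y') - comp (G ν y') (Λ μ y)) := fun μ y ν y' => hC _ _ (hΛ μ y) (hG ν y')
  have hWg : ∀ μ y ν y', Loc (((comp (Λ ν y') (V μ y) - comp (V μ y) (Λ ν y')) + (comp (Λ μ y) (V ν y') - comp (V ν y') (Λ μ y)))
      + (comp (Λ μ y) (G ν y') - comp (G ν y') (Λ μ y))) := fun μ y ν y' => (hmix μ y ν y').add (hgg μ y ν y')
  have hWd : ∀ μ y ν y', Loc ((((comp (Λ ν y') (V μ y) - comp (V μ y) (Λ ν y')) + (comp (Λ μ y) (V ν y') - comp (V ν y') (Λ μ y)))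
      + (comp (Λ μ y) (G ν y') - comp (G ν y') (Λ μ y))) + Nr μ y ν y') := fun μ y ν y' => (hWg μ y ν y').add (hNr μ y ν y')
  rw [show (fun μ' y => V μ' y + G μ' y) = V + G from rfl,
    show (fun μ' y ν' y' => W μ' y ν' y'
          + ((((comp (Λ ν' y') (V μ' y) - comp (V μ' y) (Λ ν' y')) + (comp (Λ μ' y) (V ν' y') - comp (V ν' y') (Λ μ' y)))
            + (comp (Λ μ' y) (G ν' y') - comp (G ν' y') (Λ μ' y))) + Nr μ' y ν' y'))
      = W + fun μ' y ν' y' => ((((comp (Λ ν' y') (V μ' y) - comp (V μ' y) (Λ ν' y')) + (comp (Λ μ' y) (V ν' y') - comp (V ν' y') (Λ μ' y)))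
            + (comp (Λ μ' y) (G ν' y') - comp (G ν' y') (Λ μ' y))) + Nr μ' y ν' y') from rfl,
    hessKer_add_add hK hV hG hW hWd μ ν z]
  -- the three letters and the null remainder
  rw [tadpole_add hK (hWg μ 0 ν z) (hNr μ 0 ν z), hN0, tadpole_add hK (hmix μ 0 ν z) (hgg μ 0 ν z),
    tadpole_add hK (hC _ _ (hΛ ν z) (hV μ 0)) (hC _ _ (hΛ μ 0) (hV ν z)),
    bubble_gauge_right hK (hV μ 0) (hG ν z) (hΛ ν z) (hsand ν z), bubble_gauge_left hK (hV ν z) (hG μ 0) (hΛ μ 0) (hsand μ 0),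
    bubble_gauge_left hK (hG ν z) (hG μ 0) (hΛ μ 0) (hsand μ 0)]
  ring

omit hG hsand in
/-- [folklore] **THE TWO-SIDED-INVERSE INSTANCE**: with `K∘M = M∘K = 1` and `G μ y := Λ μ y∘M − M∘Λ μ y` the sandwich letter is `sandwich_of_inverse`, so the
invariance holds with the commutator vertices (the infinitesimal background-gauge invariance of `½ log det M`, as algebra). -/
theorem hessKer_columnGauge_of_inverse {M : MKer D F} (hM : Spr M) (hKM : comp K M = idK) (hMK : comp M K = idK) (μ ν : Fin D) (z : Fin D → ℤ) :
    hessKer K (fun μ' y => V μ' y + (comp (Λ μ' y) M - comp M (Λ μ' y)))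
        (fun μ' y ν' y' => W μ' y ν' y'
          + ((((comp (Λ ν' y') (V μ' y) - comp (V μ' y) (Λ ν' y')) + (comp (Λ μ' y) (V ν' y') - comp (V ν' y') (Λ μ' y)))
            + (comp (Λ μ' y) (comp (Λ ν' y') M - comp M (Λ ν' y')) - comp (comp (Λ ν' y') M - comp M (Λ ν' y')) (Λ μ' y))) + Nr μ' y ν' y')) μ ν z
      = hessKer K V W μ ν z :=
  hessKer_columnGauge hK hV (fun μ y => loc_comm_spr hM (hΛ μ y)) hΛ hW
    (fun μ y => sandwich_of_inverse hK hM hKM hMK (hΛ μ y)) hNr hN0 μ ν z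

end Invariance

end Summit.QuantumFields.BalabanUV.Beta.D1BFx.ColumnGaugeInvariance

end

/-! ## §3 (appended, gen 23) The RELATIVE-inverse form of the sandwich letter — the shape the road's kernels carry
(`ChartConjugationRelative.RelInv K 𝕄 E`: `E∘K = K`, `K∘E = K`, `(K∘𝕄)∘E = E`, `(E∘𝕄)∘K = E`; an2 R-D1-g44-2 (3)(a): «sandwich letter in the
RELATIVE-inverse form for `G` against `G₀^{bm}`»).  With a generator commuting with the slice projector, `Λ∘E = E∘Λ`, the commutator vertex
`G := Λ∘𝕄 − 𝕄∘Λ` satisfies the SAME letter `K∘G∘K = K∘Λ − Λ∘K`, so `hessKer_columnGauge` applies verbatim. [folklore] -/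

noncomputable section

namespace Summit.QuantumFields.BalabanUV.Beta.D1BFx.ColumnGaugeInvariance

open Literature.MathematicalPhysics.QuantumFieldTheory.Balaban1983to89
open Literature.MathematicalPhysics.QuantumFieldTheory.Balaban1983to89.Beta
open ExpKernelCalculus (MKer comp tr tadpole bubble hessKer)
open Summit.QuantumFields.BalabanUV.Beta.TameKernelCalculus
open Summit.QuantumFields.BalabanUV.Beta.ChartConjugationRelative (RelInv spr_comp)

section RelativeInverse

variable {D : ℕ} {F : Type*} [Fintype F] [DecidableEq F] {K : MKer D F} (hK : Spr K)
include hK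

omit [DecidableEq F] in
/-- [folklore] **THE SANDWICH FROM A RELATIVE INVERSE**: `RelInv K 𝕄 E` (all spread), a localised generator `Λ` with `Λ∘E = E∘Λ` ⟹
`K∘(Λ∘𝕄 − 𝕄∘Λ)∘K = K∘Λ − Λ∘K`.  (`K∘Λ∘𝕄∘K = K∘E∘Λ∘𝕄∘K = K∘Λ∘(E∘𝕄∘K) = K∘Λ∘E = K∘Λ` and `K∘𝕄∘Λ∘K = K∘𝕄∘Λ∘E∘K = (K∘𝕄∘E)∘Λ∘K = E∘Λ∘K = Λ∘E∘K = Λ∘K`.) -/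
theorem sandwich_of_relInv {M E Λ : MKer D F} (hM : Spr M) (hE : Spr E) (hR : RelInv K M E) (hΛ : Loc Λ) (hΛE : comp Λ E = comp E Λ) :
    comp (comp K (comp Λ M - comp M Λ)) K = comp K Λ - comp Λ K := by
  obtain ⟨hEK, hKE, hKME, hEMK⟩ := hR
  have hΛM : Loc (comp Λ M) := hΛ.comp_spr hM
  have hMΛ : Loc (comp M Λ) := hM.comp_loc hΛ
  rw [comp_sub_right_tame hK.tame hΛM.tame hMΛ.tame, comp_sub_left_tame (hK.comp_loc hΛM).tame (hK.comp_loc hMΛ).tame hK.tame]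
  -- `(K∘(Λ∘M))∘K = K∘Λ`
  have e1 : comp (comp K (comp Λ M)) K = comp K Λ := by
    have hEM : Spr (comp E M) := spr_comp hE hM
    calc comp (comp K (comp Λ M)) K
        = comp (comp (comp K E) (comp Λ M)) K := by rw [hKE]
      _ = comp (comp K (comp (comp E Λ) M)) K := by
          rw [← comp_assoc_tame hK.tame hE.tame hΛM.tame, comp_assoc_tame hE.tame hΛ.tame hM.tame]
      _ = comp (comp K (comp (comp Λ E) M)) K := by rw [hΛE]
      _ = comp (comp K (comp Λ (comp E M))) K := by rw [← comp_assoc_tame hΛ.tame hE.tame hM.tame]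
      _ = comp K (comp Λ (comp (comp E M) K)) := by
          rw [← comp_assoc_tame hK.tame (hΛ.comp_spr hEM).tame hK.tame, ← comp_assoc_tame hΛ.tame hEM.tame hK.tame]
      _ = comp K (comp Λ E) := by rw [hEMK]
      _ = comp K (comp E Λ) := by rw [hΛE]
      _ = comp (comp K E) Λ := by rw [comp_assoc_tame hK.tame hE.tame hΛ.tame]
      _ = comp K Λ := by rw [hKE]
  -- `(K∘(M∘Λ))∘K = Λ∘K`
  have e2 : comp (comp K (comp M Λ)) K = comp Λ K := by
    have hKM : Spr (comp K M) := spr_comp hK hM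
    calc comp (comp K (comp M Λ)) K
        = comp (comp K (comp M Λ)) (comp E K) := by rw [hEK]
      _ = comp (comp (comp K (comp M Λ)) E) K := by
          rw [comp_assoc_tame (hK.comp_loc hMΛ).tame hE.tame hK.tame]
      _ = comp (comp (comp (comp K M) Λ) E) K := by rw [comp_assoc_tame hK.tame hM.tame hΛ.tame]
      _ = comp (comp (comp K M) (comp Λ E)) K := by rw [comp_assoc_tame hKM.tame hΛ.tame hE.tame]
      _ = comp (comp (comp K M) (comp E Λ)) K := by rw [hΛE]
      _ = comp (comp (comp (comp K M) E) Λ) K := by rw [← comp_assoc_tame hKM.tame hE.tame hΛ.tame]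
      _ = comp (comp E Λ) K := by rw [hKME]
      _ = comp (comp Λ E) K := by rw [hΛE]
      _ = comp Λ (comp E K) := by rw [comp_assoc_tame hΛ.tame hE.tame hK.tame]
      _ = comp Λ K := by rw [hEK]
  rw [e1, e2]

omit [DecidableEq F] in
/-- [folklore] **THE RELATIVE-INVERSE INSTANCE OF COLUMN-GAUGE INVARIANCE**: `RelInv K 𝕄 E` (spread), localised `V`, `W`, `Nr` (tadpole-null), localised
generators `Λ μ y` commuting with `E`; with the commutator vertices `G μ y := Λ μ y∘𝕄 − 𝕄∘Λ μ y` and the `Wmix`∕`Wgg` letters of `hessKer_columnGauge`,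
`hessKer K (V + G) (W + ((Wmix + Wgg) + Nr)) μ ν z = hessKer K V W μ ν z`. -/
theorem hessKer_columnGauge_of_relInv {M E : MKer D F} (hM : Spr M) (hE : Spr E) (hR : RelInv K M E)
    {V Λ : Fin D → (Fin D → ℤ) → MKer D F} {W Nr : Fin D → (Fin D → ℤ) → Fin D → (Fin D → ℤ) → MKer D F}
    (hV : ∀ μ y, Loc (V μ y)) (hΛ : ∀ μ y, Loc (Λ μ y)) (hΛE : ∀ μ y, comp (Λ μ y) E = comp E (Λ μ y))
    (hW : ∀ μ y ν y', Loc (W μ y ν y')) (hNr : ∀ μ y ν y', Loc (Nr μ y ν y')) (hN0 : ∀ μ y ν y', tadpole K (Nr μ y ν y') = 0)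
    (μ ν : Fin D) (z : Fin D → ℤ) :
    hessKer K (fun μ' y => V μ' y + (comp (Λ μ' y) M - comp M (Λ μ' y)))
        (fun μ' y ν' y' => W μ' y ν' y'
          + ((((comp (Λ ν' y') (V μ' y) - comp (V μ' y) (Λ ν' y')) + (comp (Λ μ' y) (V ν' y') - comp (V ν' y') (Λ μ' y)))
            + (comp (Λ μ' y) (comp (Λ ν' y') M - comp M (Λ ν' y')) - comp (comp (Λ ν' y') M - comp M (Λ ν' y')) (Λ μ' y))) + Nr μ' y ν' y')) μ ν z
      = hessKer K V W μ ν z :=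
  hessKer_columnGauge hK hV (fun μ y => loc_comm_spr hM (hΛ μ y)) hΛ hW
    (fun μ y => sandwich_of_relInv hK hM hE hR (hΛ μ y) (hΛE μ y)) hNr hN0 μ ν z

end RelativeInverse

end Summit.QuantumFields.BalabanUV.Beta.D1BFx.ColumnGaugeInvariance

end
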